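import Literature.NumberTheory.Automorphic.UnramifiedOrbitalEulerOfAdmissible
import Literature.NumberTheory.Rogawski1990.StableClassRegular
import HarnessLib

/-!
# Scalar pull-out for the stable orbital sum: `Φ^{st}_{μA}(𝒪, f) = β(𝒪) · Φ^{st}_m(𝒪, f)` when `μA = β • m` on the classes of `𝒪`
(Rogawski, *Automorphic Representations of Unitary Groups in Three Variables* (1990), §4.3 pp. 43–44, §5.4 (5.4.3) p. 72,
§14.5 pp. 237–238 (print))

Topic `NumberTheory/Automorphic`; namespaces `Literature.NumberTheory.Rogawski1990` (§1, two dot-notation extensions of ★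
`StableClass`, declared with their absolute names per CONVENTIONS §2) and `Literature.NumberTheory.Automorphic.UnitaryGroup`
(§2–§4).  THEOREMS ONLY over accepted tree modules: no definition, no named fact, no instance, no notation, no `sorry`.

WHY.  The T1 engine line of the crux H413 (`Cruxes/H413/Lines/F0_T1InnerFormTraceIdentity.lean`) carries on its J-side ONE adelic
orbital measure family `μA` indexed by the rational classes of the inner form `G′ = U(H)` (pin (viii″): `J(𝒪_st, f′) =
(eSt 𝒪_st).orbitalSum (Φ_{μA}(·, f′))`, ★ `UnitaryGroup.adelicClassOrbitalIntegral`), and the PER-CLASS β-socket (viii‴) «at every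
REGULAR rational class `c`, `μA c = ENNReal.ofReal b • AdelicOrbitalMeasureFamily.ofLocal m^{G′} m^{G′}_∞ c`, `0 < b`»; its
edition 1.20 pins the STABLE-CLASS form `b = α(𝒪_st(c))` [§5.4 (5.4.3) p. 72: the coefficient of `Φ^{st}(γ, f)` in `SJ_G(𝒪_st, f)`
depends on the stable class only].  This file is the measure-free algebra that turns such a socket into the rewrite the laws
`SimpleTraceFormula` ∕ `EllipticStabilisation` consume: `J(𝒪_st, f′) = α(𝒪_st) · Φ^{st,𝐀}_{ofLocal}(𝒪_st, f′)` at every regular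
`𝒪_st`, and the summed O-expansion split into its regular part (rewritten) and its singular remainder.

* §1 `StableClass.orbitalSum_congr_of_ofConjClass_eq` (`SΦ(𝒪) = SΨ(𝒪)` if `Φ = Ψ` on the classes OF `𝒪`) and
  `StableClass.orbitalSum_mul_of_ofConjClass_eq` (a weight constant on the classes of `𝒪` factors out of `S(w·Φ)(𝒪)`; the
  all-classes version is ★ `StableClass.orbitalSum_mul_of_fibrewise`).
* §2 the class term in the socket's shape `μA c = ENNReal.ofReal b • m c`, `0 ≤ b`: `adelicClassOrbitalIntegral_eq_mul_of_eq_ofReal_smul`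
  (`Φ_{μA}(c, f) = b · Φ_m(c, f)`) — a one-line reading of ★ `adelicClassOrbitalIntegral_eq_toReal_mul_of_eq_smul`
  (`UnramifiedOrbitalEulerOfAdmissible` §0, REUSED by name, not restated).
* §3 the stable orbital sum: `adelicStableOrbitalIntegral_eq_orbitalSum_mul_of_eq_ofReal_smul` (class-DEPENDENT weights on the
  classes of `𝒪`), `adelicStableOrbitalIntegral_eq_mul_of_eq_ofReal_smul` (a weight constant on `𝒪`, indexed by the stable class
  `𝒪` itself — read off ★ `adelicStableOrbitalIntegral_stableClassOf_eq_toReal_mul_of_forall_eq_smul`, which is indexed by a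
  representative `γ₀` and `conjClassesIn γ₀`), and THE β-SOCKET READING
  `adelicStableOrbitalIntegral_eq_mul_of_isRegular`: from `∀ c, IsRegularElt (out c) → μA c = ENNReal.ofReal (β (𝒪_st(c))) • m c`
  (hypothesis verbatim in the line's (viii‴)∕(viii⁵) shape) conclude `Φ^{st}_{μA}(𝒪, f) = β(𝒪) · Φ^{st}_m(𝒪, f)` at every REGULAR
  stable class `𝒪` (★ `StableClass.IsRegular.isRegularElt_out_of_ofConjClass_eq`: every class of a regular stable class has a
  regular chosen representative); the same in pin (viii″)'s spelling `𝒪.orbitalSum (Φ_{μA}(·, f))`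
  (`orbitalSum_adelicClassOrbitalIntegral_eq_mul_of_isRegular`) and in the KIT-INDEXED form over `eSt : StClass ≃ StableClass`,
  `α : StClass → ℝ`, relation `μA c = ENNReal.ofReal (α (eSt.symm (𝒪_st(c)))) • m c` (edition 1.20's (viii⁵) verbatim):
  `orbitalSum_adelicClassOrbitalIntegral_equiv_eq_mul_of_isRegular` — `J(s, f′) = α(s) · Φ^{st,𝐀}_m(eSt s, f′)`.
* §4 summed: `finsum_adelicStableOrbitalIntegral_eq_finsum_mul_of_eq_ofReal_smul` (all-class relation) and the SPLIT
  `finsum_adelicStableOrbitalIntegral_eq_add_of_isRegular` (regular-only relation, finite support): `Σᶠ_𝒪 Φ^{st}_{μA}(𝒪, f) =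
  Σᶠ_𝒪 [𝒪 regular] β(𝒪) Φ^{st}_m(𝒪, f) + Σᶠ_𝒪 [𝒪 singular] Φ^{st}_{μA}(𝒪, f)` — the identity class is never regular, so no
  unconditional «all classes» rewrite is claimed from a regular-only socket.

Everything holds for every rank `N`, any two families `μA m`, and ANY family of σ-algebras on the adelic orbit quotients (the
line fixes them to `borel` by `letI`; the statements here are generic in the instance so they unify with that choice).

* §5 (ed. 2) the bookkeeping between the explicit weights and (viii⁵): a class function `a` with `a c = a c′` for corresponding regular
  `out c ↔ out c′` is `α ∘ ofConjClass` on the regular classes (`StableClass.exists_fun_eq_comp_ofConjClass_of_forall_eq`,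
  `exists_fun_stableClass_eq_of_forall_corresponds_eq`), so a per-class socket `μA c = ENNReal.ofReal (a c) • m c` with such weights IS
  the stable-class socket `μA c = ENNReal.ofReal (α (𝒪_st(c))) • m c` (`exists_fun_stableClass_eq_ofReal_smul_of_forall_corresponds_eq`).

## References
* J. D. Rogawski, *Automorphic Representations of Unitary Groups in Three Variables*, Ann. of Math. Stud. 123 (1990), §4.1
  (4.1.1) p. 40, §4.3 pp. 43–44, §5.4 (5.4.3) p. 72, §14.5 pp. 237–238 (print) [Rogawski1990].
-/

set_option autoImplicit false

noncomputable section

open MeasureTheory Measure Set Function NumberField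
open scoped ENNReal NNReal

/-! ## §1 Fibrewise congruence and weight pull-out for `StableClass.orbitalSum` on the classes of ONE stable class -/

namespace Literature.NumberTheory.Rogawski1990

open Literature.AlgebraicGeometry.ShimuraVarieties (unitaryGroup)

section Fibrewise

variable {R : Type*} [CommRing R] {n : Type*} [Fintype n] [DecidableEq n] {σ : R →+* R} {H : Matrix n n R}
  {S : Type*} [CommRing S]

/-- `SΦ(𝒪_st) = SΨ(𝒪_st)` as soon as `Φ` and `Ψ` agree on the conjugacy classes lying in `𝒪_st` (the stable orbital sum
`Σ_{[γ′] ⊂ 𝒪_st} Φ[γ′]` only reads those classes). [cite: Rogawski1990, §4.1 (4.1.1) p. 40] -/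
theorem StableClass.orbitalSum_congr_of_ofConjClass_eq (Φ Ψ : ConjClasses (unitaryGroup σ H) → S) (𝒪 : StableClass σ H)
    (h : ∀ c, StableClass.ofConjClass c = 𝒪 → Φ c = Ψ c) : 𝒪.orbitalSum Φ = 𝒪.orbitalSum Ψ := by
  rw [StableClass.orbitalSum_eq_finsum_mem_preimage, StableClass.orbitalSum_eq_finsum_mem_preimage]
  exact finsum_mem_congr rfl fun c hc => h c hc

/-- **A weight constant on the classes of `𝒪_st` factors out of `S(w·Φ)(𝒪_st)`**: if `w[γ′] = W` for every `[γ′] ⊂ 𝒪_st` then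
`𝒪_st.orbitalSum ([γ′] ↦ w[γ′] · Φ[γ′]) = W · SΦ(𝒪_st)` (per-class form of ★ `StableClass.orbitalSum_mul_of_fibrewise`, whose
hypothesis is on ALL classes; here only the classes of `𝒪_st` are constrained — the shape of a socket that holds on the regular
classes only). [cite: Rogawski1990, §5.4 (5.4.3) p. 72] -/
theorem StableClass.orbitalSum_mul_of_ofConjClass_eq [NoZeroDivisors S] (Φ w : ConjClasses (unitaryGroup σ H) → S)
    (𝒪 : StableClass σ H) (W : S) (hw : ∀ c, StableClass.ofConjClass c = 𝒪 → w c = W) :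
    𝒪.orbitalSum (fun c => w c * Φ c) = W * 𝒪.orbitalSum Φ := by
  rw [StableClass.orbitalSum_congr_of_ofConjClass_eq (fun c => w c * Φ c) (fun c => W * Φ c) 𝒪
      (fun c hc => by rw [hw c hc]),
    StableClass.orbitalSum_eq_finsum_mem_preimage, StableClass.orbitalSum_eq_finsum_mem_preimage, mul_finsum_mem]

end Fibrewise

end Literature.NumberTheory.Rogawski1990

namespace Literature.NumberTheory.Automorphic

namespace UnitaryGroup

open Literature.NumberTheory.Rogawski1990
open Literature.AlgebraicGeometry.ShimuraVarieties (unitaryGroup)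

variable (L : Type) [Field L] [NumberField L] [IsCMField L] (N : ℕ) (H : Matrix (Fin N) (Fin N) L)
  [∀ g : (cmDatum L N H).Adelic,
    MeasurableSpace ((cmDatum L N H).Adelic ⧸ Subgroup.centralizer ({g} : Set (cmDatum L N H).Adelic))]

/-! ## §2 The class term in the β-socket's shape -/

section ClassTerm

variable {μA m : AdelicOrbitalMeasureFamily L N H}

/-- **The class term rescales with the measure**, in the β-socket's shape `μA c = ENNReal.ofReal b • m c`, `0 ≤ b`:
`Φ_{μA}(c, f) = b · Φ_m(c, f)` (★ `adelicClassOrbitalIntegral_eq_toReal_mul_of_eq_smul` + `ENNReal.toReal_ofReal` — the only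
dependence of `Φ(γ, f) = ∫_{G_γ(𝔸)\G(𝔸)} f(g⁻¹γg) dg` on the normalisation of `dg`). [cite: Rogawski1990, §4.3 pp. 43–44] -/
theorem adelicClassOrbitalIntegral_eq_mul_of_eq_ofReal_smul {c : ConjClasses (cmDatum L N H).Rational} {b : ℝ} (hb : 0 ≤ b)
    (h : μA c = ENNReal.ofReal b • m c) (f : (cmDatum L N H).Adelic → ℂ) :
    adelicClassOrbitalIntegral L N H μA f c = (b : ℂ) * adelicClassOrbitalIntegral L N H m f c := by
  rw [adelicClassOrbitalIntegral_eq_toReal_mul_of_eq_smul L N H c μA m (ENNReal.ofReal b) h, ENNReal.toReal_ofReal hb]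

end ClassTerm

/-! ## §3 The stable orbital sum: `Φ^{st}_{μA}(𝒪, f) = β(𝒪) · Φ^{st}_m(𝒪, f)` -/

section StableSum

variable {μA m : AdelicOrbitalMeasureFamily L N H}

/-- **Class-dependent weights on the classes of one stable class**: if `μA c = ENNReal.ofReal (b c) • m c` with `0 ≤ b c` for every
rational class `c` lying in `𝒪_st`, then `Φ^{st}_{μA}(𝒪_st, f) = 𝒪_st.orbitalSum ([γ] ↦ b[γ] · Φ_m(γ, f))`.
[cite: Rogawski1990, §5.4 (5.4.3) p. 72] -/
theorem adelicStableOrbitalIntegral_eq_orbitalSum_mul_of_eq_ofReal_smul (b : ConjClasses (cmDatum L N H).Rational → ℝ)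
    (𝒪 : StableClass (cmConjRingHom L) H) (hb : ∀ c, StableClass.ofConjClass c = 𝒪 → 0 ≤ b c)
    (h : ∀ c, StableClass.ofConjClass c = 𝒪 → μA c = ENNReal.ofReal (b c) • m c) (f : (cmDatum L N H).Adelic → ℂ) :
    adelicStableOrbitalIntegral L N H μA f 𝒪 =
      𝒪.orbitalSum fun c => (b c : ℂ) * adelicClassOrbitalIntegral L N H m f c :=
  StableClass.orbitalSum_congr_of_ofConjClass_eq _ _ 𝒪 fun c hc =>
    adelicClassOrbitalIntegral_eq_mul_of_eq_ofReal_smul L N H (hb c hc) (h c hc) f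

/-- **A weight constant on the stable class factors out**: if `μA c = ENNReal.ofReal b • m c` (`0 ≤ b`, ONE `b`) for every
rational class `c` lying in `𝒪_st`, then `Φ^{st}_{μA}(𝒪_st, f) = b · Φ^{st}_m(𝒪_st, f)` — indexed by the stable class `𝒪_st` itself
(the consumer's `eSt s`), read off ★ `adelicStableOrbitalIntegral_stableClassOf_eq_toReal_mul_of_forall_eq_smul` (indexed by a
representative `γ₀`; `ofConjClass c = 𝒪_st(γ₀) ↔ c ∈ conjClassesIn γ₀` definitionally). [cite: Rogawski1990, §5.4 (5.4.3) p. 72] -/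
theorem adelicStableOrbitalIntegral_eq_mul_of_eq_ofReal_smul {𝒪 : StableClass (cmConjRingHom L) H} {b : ℝ} (hb : 0 ≤ b)
    (h : ∀ c, StableClass.ofConjClass c = 𝒪 → μA c = ENNReal.ofReal b • m c) (f : (cmDatum L N H).Adelic → ℂ) :
    adelicStableOrbitalIntegral L N H μA f 𝒪 = (b : ℂ) * adelicStableOrbitalIntegral L N H m f 𝒪 := by
  obtain ⟨γ₀, rfl⟩ := stableClassOf_surjective 𝒪
  rw [adelicStableOrbitalIntegral_stableClassOf_eq_toReal_mul_of_forall_eq_smul L N H μA m (ENNReal.ofReal b)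
    (fun c hc => h c hc) f, ENNReal.toReal_ofReal hb]

/-- **THE β-SOCKET READING at a regular stable class**: suppose that at every REGULAR rational class `c` (regular chosen
representative `out c`, ★ `IsRegularElt`) the family `μA` is `β(𝒪_st(c)) • m c` for a weight `β` on the stable classes that is
non-negative on the regular ones — the T1 line's pins (viii‴)∕(viii⁵) with `m := AdelicOrbitalMeasureFamily.ofLocal m^{G′} m^{G′}_∞`
and `β := α ∘ eSt⁻¹`.  Then at every REGULAR stable class `𝒪_st`: `Φ^{st}_{μA}(𝒪_st, f) = β(𝒪_st) · Φ^{st}_m(𝒪_st, f)` — with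
(viii″) `J(𝒪_st, f′) = Φ^{st}_{μA}(𝒪_st, f′)` this is `J(𝒪_st, f′) = α(𝒪_st) · Φ^{st,𝐀}_{ofLocal}(𝒪_st, f′)`, the stable-class form of
the coefficient `ε_st(γ₀)⁻¹ z_G(γ) τ(G)` of (5.4.3) (every class inside a regular stable class has a regular chosen representative,
★ `StableClass.IsRegular.isRegularElt_out_of_ofConjClass_eq`). [cite: Rogawski1990, §5.4 (5.4.3) p. 72; §14.5 p. 238] -/
theorem adelicStableOrbitalIntegral_eq_mul_of_isRegular (β : StableClass (cmConjRingHom L) H → ℝ)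
    (hβ : ∀ c : ConjClasses (cmDatum L N H).Rational, IsRegularElt ((Quotient.out c).val : GL (Fin N) L) →
      μA c = ENNReal.ofReal (β (StableClass.ofConjClass c)) • m c)
    (hβ0 : ∀ 𝒪 : StableClass (cmConjRingHom L) H, 𝒪.IsRegular → 0 ≤ β 𝒪)
    {𝒪 : StableClass (cmConjRingHom L) H} (h𝒪 : 𝒪.IsRegular) (f : (cmDatum L N H).Adelic → ℂ) :
    adelicStableOrbitalIntegral L N H μA f 𝒪 = (β 𝒪 : ℂ) * adelicStableOrbitalIntegral L N H m f 𝒪 :=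
  adelicStableOrbitalIntegral_eq_mul_of_eq_ofReal_smul L N H (hβ0 𝒪 h𝒪)
    (fun c hc => by rw [hβ c (h𝒪.isRegularElt_out_of_ofConjClass_eq hc), hc]) f

/-- The same with the socket in its EXISTENTIAL per-class form «`∀ c` regular, `∃ b, 0 < b ∧ μA c = ENNReal.ofReal b • m c`» PLUS the
identification of the witnesses on the classes of `𝒪_st` with one `b₀` (the content edition 1.20 adds to (viii‴)): then
`Φ^{st}_{μA}(𝒪_st, f) = b₀ · Φ^{st}_m(𝒪_st, f)`. [cite: Rogawski1990, §5.4 (5.4.3) p. 72; §14.5 p. 238] -/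
theorem adelicStableOrbitalIntegral_eq_mul_of_isRegular_of_forall_eq {𝒪 : StableClass (cmConjRingHom L) H} (h𝒪 : 𝒪.IsRegular)
    {b₀ : ℝ} (hb₀ : 0 ≤ b₀)
    (hβ : ∀ c : ConjClasses (cmDatum L N H).Rational, StableClass.ofConjClass c = 𝒪 →
      IsRegularElt ((Quotient.out c).val : GL (Fin N) L) → μA c = ENNReal.ofReal b₀ • m c)
    (f : (cmDatum L N H).Adelic → ℂ) :
    adelicStableOrbitalIntegral L N H μA f 𝒪 = (b₀ : ℂ) * adelicStableOrbitalIntegral L N H m f 𝒪 :=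
  adelicStableOrbitalIntegral_eq_mul_of_eq_ofReal_smul L N H hb₀
    (fun c hc => hβ c hc (h𝒪.isRegularElt_out_of_ofConjClass_eq hc)) f

/-- `𝒪_st.orbitalSum ([γ] ↦ Φ_m(γ, f)) = Φ^{st}_m(𝒪_st, f)` — the line's pin (viii″) writes `J(𝒪_st, f′)` as the left-hand side
(★ `StableClass.orbitalSum` of ★ `adelicClassOrbitalIntegral`), this file's §3 as the right-hand side (definitional).
[cite: Rogawski1990, §4.1 (4.1.1) p. 40] -/
theorem orbitalSum_adelicClassOrbitalIntegral (m : AdelicOrbitalMeasureFamily L N H) (f : (cmDatum L N H).Adelic → ℂ)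
    (𝒪 : StableClass (cmConjRingHom L) H) :
    𝒪.orbitalSum (adelicClassOrbitalIntegral L N H m f) = adelicStableOrbitalIntegral L N H m f 𝒪 := rfl

/-- **The β-socket reading in pin (viii″)'s `orbitalSum` spelling**: under the regular-class relation
`μA c = β(𝒪_st(c)) • m c`, at every regular `𝒪_st`:
`𝒪_st.orbitalSum (Φ_{μA}(·, f)) = β(𝒪_st) · 𝒪_st.orbitalSum (Φ_m(·, f))`. [cite: Rogawski1990, §5.4 (5.4.3) p. 72; §14.5 p. 238] -/
theorem orbitalSum_adelicClassOrbitalIntegral_eq_mul_of_isRegular (β : StableClass (cmConjRingHom L) H → ℝ)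
    (hβ : ∀ c : ConjClasses (cmDatum L N H).Rational, IsRegularElt ((Quotient.out c).val : GL (Fin N) L) →
      μA c = ENNReal.ofReal (β (StableClass.ofConjClass c)) • m c)
    (hβ0 : ∀ 𝒪 : StableClass (cmConjRingHom L) H, 𝒪.IsRegular → 0 ≤ β 𝒪)
    {𝒪 : StableClass (cmConjRingHom L) H} (h𝒪 : 𝒪.IsRegular) (f : (cmDatum L N H).Adelic → ℂ) :
    𝒪.orbitalSum (adelicClassOrbitalIntegral L N H μA f) = (β 𝒪 : ℂ) * 𝒪.orbitalSum (adelicClassOrbitalIntegral L N H m f) :=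
  adelicStableOrbitalIntegral_eq_mul_of_isRegular L N H β hβ hβ0 h𝒪 f

/-- **The kit-indexed form** (the T1 line's `StClass`, `eSt : StClass ≃ StableClass`, `α : StClass → ℝ`): if at every regular
rational class `μA c = ENNReal.ofReal (α (eSt⁻¹ (𝒪_st(c)))) • m c` — edition 1.20's pin (viii⁵) verbatim — and `α` is
non-negative at the kit classes whose stable class is regular, then for every kit class `s` with `(eSt s)` regular:
`(eSt s).orbitalSum (Φ_{μA}(·, f)) = α(s) · (eSt s).orbitalSum (Φ_m(·, f))`, i.e. with (viii″) `J(s, f′) = α(s) · Φ^{st,𝐀}_m(eSt s, f′)`.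
[cite: Rogawski1990, §5.4 (5.4.3) p. 72; §14.5 p. 238] -/
theorem orbitalSum_adelicClassOrbitalIntegral_equiv_eq_mul_of_isRegular {St : Type*} (eSt : St ≃ StableClass (cmConjRingHom L) H)
    (α : St → ℝ)
    (hα : ∀ c : ConjClasses (cmDatum L N H).Rational, IsRegularElt ((Quotient.out c).val : GL (Fin N) L) →
      μA c = ENNReal.ofReal (α (eSt.symm (StableClass.ofConjClass c))) • m c)
    (hα0 : ∀ s : St, (eSt s).IsRegular → 0 ≤ α s) {s : St} (hs : (eSt s).IsRegular) (f : (cmDatum L N H).Adelic → ℂ) :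
    (eSt s).orbitalSum (adelicClassOrbitalIntegral L N H μA f) =
      (α s : ℂ) * (eSt s).orbitalSum (adelicClassOrbitalIntegral L N H m f) := by
  have h := orbitalSum_adelicClassOrbitalIntegral_eq_mul_of_isRegular L N H (fun 𝒪 => α (eSt.symm 𝒪)) hα
    (fun 𝒪 h𝒪 => hα0 (eSt.symm 𝒪) (by rwa [Equiv.apply_symm_apply])) hs f
  rwa [Equiv.symm_apply_apply] at h

end StableSum

/-! ## §4 Summed over the stable classes -/

section Summed

variable {μA m : AdelicOrbitalMeasureFamily L N H}

/-- **All-class relation, summed**: if `μA c = β(𝒪_st(c)) • m c` at EVERY rational class (`0 ≤ β`), then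
`Σᶠ_{𝒪_st} Φ^{st}_{μA}(𝒪_st, f) = Σᶠ_{𝒪_st} β(𝒪_st) · Φ^{st}_m(𝒪_st, f)`. [cite: Rogawski1990, §14.5 pp. 237–238] -/
theorem finsum_adelicStableOrbitalIntegral_eq_finsum_mul_of_eq_ofReal_smul (β : StableClass (cmConjRingHom L) H → ℝ)
    (hβ0 : ∀ 𝒪, 0 ≤ β 𝒪)
    (hβ : ∀ c : ConjClasses (cmDatum L N H).Rational, μA c = ENNReal.ofReal (β (StableClass.ofConjClass c)) • m c)
    (f : (cmDatum L N H).Adelic → ℂ) :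
    ∑ᶠ 𝒪, adelicStableOrbitalIntegral L N H μA f 𝒪 = ∑ᶠ 𝒪, (β 𝒪 : ℂ) * adelicStableOrbitalIntegral L N H m f 𝒪 :=
  finsum_congr fun 𝒪 => adelicStableOrbitalIntegral_eq_mul_of_eq_ofReal_smul L N H (hβ0 𝒪)
    (fun c hc => by rw [hβ c, hc]) f

/-- **Regular-only relation, summed: the SPLIT of the O-expansion** — with the β-socket on the regular classes only and
`𝒪_st ↦ Φ^{st}_{μA}(𝒪_st, f)` finitely supported (the line's (viii⁗)),
`Σᶠ_{𝒪_st} Φ^{st}_{μA}(𝒪_st, f) = Σᶠ_{𝒪_st} [𝒪_st regular] β(𝒪_st) · Φ^{st}_m(𝒪_st, f) + Σᶠ_{𝒪_st} [𝒪_st singular] Φ^{st}_{μA}(𝒪_st, f)`: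
the regular elliptic terms rewritten for the class-by-class comparison of Thm. 14.5.1 (a), the singular terms left as they are
(their treatment is (4.1.2) ∕ §14.5's separate argument).  The `if`s take any `DecidablePred` instance (the line's anchored kit
supplies `Classical.propDecidable` under `open scoped Classical`, as ★ `finite_support_ite_isGRegular_mul_adelicStableOrbitalIntegralH_out`).
[cite: Rogawski1990, §14.5 pp. 237–238] -/
theorem finsum_adelicStableOrbitalIntegral_eq_add_of_isRegular (β : StableClass (cmConjRingHom L) H → ℝ)
    (hβ : ∀ c : ConjClasses (cmDatum L N H).Rational, IsRegularElt ((Quotient.out c).val : GL (Fin N) L) →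
      μA c = ENNReal.ofReal (β (StableClass.ofConjClass c)) • m c)
    (hβ0 : ∀ 𝒪 : StableClass (cmConjRingHom L) H, 𝒪.IsRegular → 0 ≤ β 𝒪) (f : (cmDatum L N H).Adelic → ℂ)
    (hfin : (Function.support (adelicStableOrbitalIntegral L N H μA f)).Finite)
    [DecidablePred fun 𝒪 : StableClass (cmConjRingHom L) H => 𝒪.IsRegular] :
    ∑ᶠ 𝒪, adelicStableOrbitalIntegral L N H μA f 𝒪 =
      (∑ᶠ 𝒪 : StableClass (cmConjRingHom L) H,
          if 𝒪.IsRegular then (β 𝒪 : ℂ) * adelicStableOrbitalIntegral L N H m f 𝒪 else 0) +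
        ∑ᶠ 𝒪 : StableClass (cmConjRingHom L) H, if 𝒪.IsRegular then 0 else adelicStableOrbitalIntegral L N H μA f 𝒪 := by
  have hsplit : ∀ 𝒪 : StableClass (cmConjRingHom L) H, adelicStableOrbitalIntegral L N H μA f 𝒪 =
      (if 𝒪.IsRegular then (β 𝒪 : ℂ) * adelicStableOrbitalIntegral L N H m f 𝒪 else 0) +
        (if 𝒪.IsRegular then 0 else adelicStableOrbitalIntegral L N H μA f 𝒪) := by
    intro 𝒪
    by_cases h𝒪 : 𝒪.IsRegular
    · rw [if_pos h𝒪, if_pos h𝒪, add_zero]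
      exact adelicStableOrbitalIntegral_eq_mul_of_isRegular L N H β hβ hβ0 h𝒪 f
    · rw [if_neg h𝒪, if_neg h𝒪, zero_add]
  have hreg : (Function.support fun 𝒪 : StableClass (cmConjRingHom L) H =>
      if 𝒪.IsRegular then (β 𝒪 : ℂ) * adelicStableOrbitalIntegral L N H m f 𝒪 else 0).Finite := by
    refine hfin.subset fun 𝒪 h𝒪 => ?_
    rw [Function.mem_support] at h𝒪 ⊢
    by_cases hr : 𝒪.IsRegular
    · rw [if_pos hr] at h𝒪
      rwa [adelicStableOrbitalIntegral_eq_mul_of_isRegular L N H β hβ hβ0 hr f]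
    · exact absurd (if_neg hr) h𝒪
  have hsing : (Function.support fun 𝒪 : StableClass (cmConjRingHom L) H =>
      if 𝒪.IsRegular then 0 else adelicStableOrbitalIntegral L N H μA f 𝒪).Finite := by
    refine hfin.subset fun 𝒪 h𝒪 => ?_
    rw [Function.mem_support] at h𝒪 ⊢
    by_cases hr : 𝒪.IsRegular
    · exact absurd (if_pos hr) h𝒪
    · rwa [if_neg hr] at h𝒪
  rw [← finsum_add_distrib hreg hsing]
  exact finsum_congr hsplit

end Summed

end UnitaryGroup

end Literature.NumberTheory.Automorphic

/-! ## §5 (ed. 2) Weights constant on the regular stable classes FACTOR through `StableClass.ofConjClass`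

The explicit geometric side names the β-socket weights class by class (`a [γ] = vol(U(H)(L⁺)_γ \ U(H)(𝔸)_γ ; t_γ)`, ★
`UnitaryGroup.exists_covolWeight_diagTrace_eq_finsum_orbitalSum`) and its reader proves them equal on stably conjugate REGULAR classes
(`a c = a c′` for `out c ↔ out c′`, coherent torus measures).  Edition 1.20's pin (viii⁵) wants the weight as a function OF THE STABLE CLASS,
`μA c = ENNReal.ofReal (α (𝒪_st(c))) • m c`.  This section is the choice-free-for-the-consumer bookkeeping in between: a class function constant on
the classes of each regular stable class is `α ∘ ofConjClass` there, for an `α` on the stable classes (`α 𝒪 := a ⟦out 𝒪⟧`). -/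

namespace Literature.NumberTheory.Rogawski1990

open Literature.AlgebraicGeometry.ShimuraVarieties (unitaryGroup)

section Factor

variable {R : Type*} [CommRing R] {n : Type*} [Fintype n] [DecidableEq n] {σ : R →+* R} {H : Matrix n n R}

/-- Two conjugacy classes lie in the same stable class iff their chosen representatives are stably conjugate. [cite: Rogawski1990, §3.1 p. 19] -/
theorem StableClass.ofConjClass_eq_ofConjClass_iff_isStablyConj_out {c c' : ConjClasses (unitaryGroup σ H)} :
    StableClass.ofConjClass c = StableClass.ofConjClass c' ↔ IsStablyConj σ H (Quotient.out c) (Quotient.out c') := by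
  conv_lhs => rw [← Quotient.out_eq c, ← Quotient.out_eq c']
  exact stableClassOf_eq_iff

/-- The conjugacy class of the chosen representative of a stable class lies in that stable class. [cite: Rogawski1990, §3.1 p. 19] -/
theorem StableClass.ofConjClass_mk_out (𝒪 : StableClass σ H) :
    StableClass.ofConjClass (ConjClasses.mk (Quotient.out (s := stableConjSetoid σ H) 𝒪)) = 𝒪 :=
  Quotient.out_eq (s := stableConjSetoid σ H) 𝒪

/-- **A class function constant on the classes of each `P`-class's stable class factors through `ofConjClass` on the `P`-classes**:
if `a c = a c′` whenever `P c` and `c, c′` lie in the same stable class, then `a c = α (𝒪_st(c))` at every `P`-class for SOME `α` on the stable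
classes (namely `α 𝒪 := a ⟦out 𝒪⟧`).  [cite: Rogawski1990, §5.4 (5.4.3) p. 72] -/
theorem StableClass.exists_fun_eq_comp_ofConjClass_of_forall_eq {S : Type*} (a : ConjClasses (unitaryGroup σ H) → S)
    (P : ConjClasses (unitaryGroup σ H) → Prop)
    (h : ∀ c c', P c → StableClass.ofConjClass c = StableClass.ofConjClass c' → a c = a c') :
    ∃ α : StableClass σ H → S, ∀ c, P c → a c = α (StableClass.ofConjClass c) :=
  ⟨fun 𝒪 => a (ConjClasses.mk (Quotient.out (s := stableConjSetoid σ H) 𝒪)), fun c hc =>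
    h c _ hc (StableClass.ofConjClass_mk_out (StableClass.ofConjClass c)).symm⟩

end Factor

end Literature.NumberTheory.Rogawski1990

namespace Literature.NumberTheory.Automorphic

namespace UnitaryGroup

open Literature.NumberTheory.Rogawski1990

section Factor

variable (L : Type) [Field L] [NumberField L] [IsCMField L] (N : ℕ) (H : Matrix (Fin N) (Fin N) L)

/-- **Weights equal on corresponding regular classes are a function of the stable class** (the (O10-c3) reader's output shape ⇒ the (viii⁵) weight):
if `a c = a c′` whenever `out c` is regular and `out c ↔ out c′` (★ `Corresponds`, i.e. stably conjugate), then there is `α : StableClass → S` with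
`a c = α (𝒪_st(c))` at every regular class. [cite: Rogawski1990, §5.4 (5.4.3) p. 72; §14.5 p. 238] -/
theorem exists_fun_stableClass_eq_of_forall_corresponds_eq {S : Type*} (a : ConjClasses (cmDatum L N H).Rational → S)
    (h : ∀ c c' : ConjClasses (cmDatum L N H).Rational, IsRegularElt ((Quotient.out c).val : GL (Fin N) L) →
      Corresponds (cmConjRingHom L) H H (Quotient.out c) (Quotient.out c') → a c = a c') :
    ∃ α : StableClass (cmConjRingHom L) H → S,
      ∀ c : ConjClasses (cmDatum L N H).Rational, IsRegularElt ((Quotient.out c).val : GL (Fin N) L) → a c = α (StableClass.ofConjClass c) :=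
  StableClass.exists_fun_eq_comp_ofConjClass_of_forall_eq a _ fun c c' hc hcc' =>
    h c c' hc (corresponds_self_iff.mpr (StableClass.ofConjClass_eq_ofConjClass_iff_isStablyConj_out.mp hcc'))

variable {L N H}
  [∀ g : (cmDatum L N H).Adelic,
    MeasurableSpace ((cmDatum L N H).Adelic ⧸ Subgroup.centralizer ({g} : Set (cmDatum L N H).Adelic))]
  {μA m : AdelicOrbitalMeasureFamily L N H}

/-- **THE (viii⁵) SHAPE from class weights + the reader's equality**: if `μA c = ENNReal.ofReal (a c) • m c` at every regular class (the per-class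
β-socket with its weights NAMED, e.g. the covolume weights of ★ `exists_covolWeight_diagTrace_eq_finsum_orbitalSum` for the patched family) and
`a c = a c′` for corresponding regular `out c ↔ out c′`, then for some `α : StableClass → ℝ` agreeing with `a` on the regular classes,
`μA c = ENNReal.ofReal (α (𝒪_st(c))) • m c` at every regular class — edition 1.20's pin (viii⁵) with `𝔨.α := α ∘ 𝔨.eSt`
(`α (𝒪_st(c)) = (α ∘ eSt) (eSt.symm (𝒪_st(c)))`). [cite: Rogawski1990, §5.4 (5.4.3) p. 72; §14.5 p. 238] -/
theorem exists_fun_stableClass_eq_ofReal_smul_of_forall_corresponds_eq (a : ConjClasses (cmDatum L N H).Rational → ℝ)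
    (hβ : ∀ c : ConjClasses (cmDatum L N H).Rational, IsRegularElt ((Quotient.out c).val : GL (Fin N) L) →
      μA c = ENNReal.ofReal (a c) • m c)
    (h : ∀ c c' : ConjClasses (cmDatum L N H).Rational, IsRegularElt ((Quotient.out c).val : GL (Fin N) L) →
      Corresponds (cmConjRingHom L) H H (Quotient.out c) (Quotient.out c') → a c = a c') :
    ∃ α : StableClass (cmConjRingHom L) H → ℝ,
      (∀ c : ConjClasses (cmDatum L N H).Rational, IsRegularElt ((Quotient.out c).val : GL (Fin N) L) →
        α (StableClass.ofConjClass c) = a c) ∧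
      ∀ c : ConjClasses (cmDatum L N H).Rational, IsRegularElt ((Quotient.out c).val : GL (Fin N) L) →
        μA c = ENNReal.ofReal (α (StableClass.ofConjClass c)) • m c := by
  obtain ⟨α, hα⟩ := exists_fun_stableClass_eq_of_forall_corresponds_eq L N H a h
  exact ⟨α, fun c hc => (hα c hc).symm, fun c hc => by rw [← hα c hc]; exact hβ c hc⟩

omit [∀ g : (cmDatum L N H).Adelic,
    MeasurableSpace ((cmDatum L N H).Adelic ⧸ Subgroup.centralizer ({g} : Set (cmDatum L N H).Adelic))] in
/-- … and then the weight is NON-NEGATIVE (indeed whatever `a` is) at the regular stable classes when `a` is: the `hα0`∕`hβ0` side condition of §3's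
readings, in the stable-class currency. [cite: Rogawski1990, §5.4 (5.4.3) p. 72] -/
theorem nonneg_of_isRegular_of_forall_eq {α : StableClass (cmConjRingHom L) H → ℝ} {a : ConjClasses (cmDatum L N H).Rational → ℝ}
    (hα : ∀ c : ConjClasses (cmDatum L N H).Rational, IsRegularElt ((Quotient.out c).val : GL (Fin N) L) →
      α (StableClass.ofConjClass c) = a c)
    (ha : ∀ c, 0 ≤ a c) {𝒪 : StableClass (cmConjRingHom L) H} (h𝒪 : 𝒪.IsRegular) : 0 ≤ α 𝒪 := by
  have hc := h𝒪.isRegularElt_out_of_ofConjClass_eq (StableClass.ofConjClass_mk_out 𝒪)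
  rw [← StableClass.ofConjClass_mk_out 𝒪, hα _ hc]
  exact ha _

end Factor

end UnitaryGroup

end Literature.NumberTheory.Automorphic
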